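import Summits.CriticalPhenomena.PercolationContinuityZ3.Theorems.SahiIsingThreeSites

/-!
# Sahi's `C₃` in spin correlations for the infinite-volume Ising states: a lower bound on the third Ursell function

Support file of the Sahi cell (`prim-sahi`, typer seat, generation 13; `--supports stmt-CriticalPhenomena-4575`).
Theorems only (no definitions, no named facts, no sorries).  Seventh file of the generation-13 Ising series; the
infinite-volume form of typer generation 4's `SahiThreeCoordinates.isingExpect_sahiC3_threeSites`.

For a box-TP₂ probability measure `μ` on `{−1,+1}^ι` (in particular the plus, minus, free and every tail-trivial
Ising Gibbs state on `ℤ^d`, generation 13) and any three sites `x, y, z`, Sahi's `E₃ ≥ 0` for the up-spin indicators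
`n_u = (1 + σ_u)/2` (a special case of `msahiE_threeSites_nonneg_of_isBoxTP2`, every FKG weight on `{−1,+1}³` being
Sahi-positive of every order), multiplied by `8` and expanded in spin moments `⟨·⟩ = ∫ · dμ`:

  `0 ≤ 2⟨σ_xσ_yσ_z⟩ + ⟨σ_xσ_y⟩ + ⟨σ_xσ_z⟩ + ⟨σ_yσ_z⟩ + ⟨σ_x⟩⟨σ_y⟩⟨σ_z⟩
       − ⟨σ_x⟩⟨σ_yσ_z⟩ − ⟨σ_y⟩⟨σ_xσ_z⟩ − ⟨σ_z⟩⟨σ_xσ_y⟩ − ⟨σ_x⟩⟨σ_y⟩ − ⟨σ_x⟩⟨σ_z⟩ − ⟨σ_y⟩⟨σ_z⟩`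

(`sahiC3_threeSites_of_isBoxTP2`), i.e. `U₃(x,y,z) ≥ −½ Σ_cyc (1 + ⟨σ_x⟩) ⟨σ_y;σ_z⟩` — a LOWER bound on the third
Ursell function of the infinite-volume states, complementary to the GHS upper bound `U₃ ≤ 0` (which needs `h ≥ 0`),
valid for every sign of `h`: `plusState_sahiC3_threeSites`, `minusState_sahiC3_threeSites` (`β ≥ 0`, any `h`),
`freeState_sahiC3_threeSites` (`h ≥ 0`), `sahiC3_threeSites_of_isTailTrivial` (every extremal state).  UNCONDITIONAL.

No sorries, no new axioms.
-/

noncomputable section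

namespace Summit.CriticalPhenomena.PercolationContinuityZ3.Theorems.SahiBoxTP2

open MeasureTheory ProbabilityTheory Set Filter Topology Function Literature.Combinatorics.Sahi2008
open Literature.Probability.LatticeModels
open scoped ENNReal

section BoxTP2

variable {ι : Type*} [Countable ι] [DecidableEq ι]

/-- The finite-weight expectation under the point weights of a finite measure on a finite type is the integral.
[folklore] -/
theorem ex_real_singleton_eq_integral {α : Type*} [Fintype α] [MeasurableSpace α] [MeasurableSingletonClass α]
    (ν : Measure α) [IsFiniteMeasure ν] (g : α → ℝ) : ex (fun a => ν.real {a}) g = ∫ a, g a ∂ν := by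
  rw [integral_fintype Integrable.of_finite, ex]
  simp only [smul_eq_mul]

/-- **Sahi's `C₃` for three spins of a box-TP₂ spin law, in spin moments** (`⟨·⟩ = ∫ · dμ`, `σ_u = spinAt u`):
`0 ≤ 2⟨σ_xσ_yσ_z⟩ + ⟨σ_xσ_y⟩ + ⟨σ_xσ_z⟩ + ⟨σ_yσ_z⟩ + ⟨σ_x⟩⟨σ_y⟩⟨σ_z⟩ − ⟨σ_x⟩⟨σ_yσ_z⟩ − ⟨σ_y⟩⟨σ_xσ_z⟩ − ⟨σ_z⟩⟨σ_xσ_y⟩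
− ⟨σ_x⟩⟨σ_y⟩ − ⟨σ_x⟩⟨σ_z⟩ − ⟨σ_y⟩⟨σ_z⟩` — `8·E₃(n_x,n_y,n_z) ≥ 0` expanded; UNCONDITIONAL. [this work] -/
theorem sahiC3_threeSites_of_isBoxTP2 (μ : Measure (ι → ℤˣ)) [IsProbabilityMeasure μ] (hμ : IsBoxTP2 μ)
    (x y z : ι) :
    0 ≤ 2 * ∫ σ, spinAt x σ * spinAt y σ * spinAt z σ ∂μ + ∫ σ, spinAt x σ * spinAt y σ ∂μ +
        ∫ σ, spinAt x σ * spinAt z σ ∂μ + ∫ σ, spinAt y σ * spinAt z σ ∂μ +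
        (∫ σ, spinAt x σ ∂μ) * (∫ σ, spinAt y σ ∂μ) * (∫ σ, spinAt z σ ∂μ) -
        (∫ σ, spinAt x σ ∂μ) * ∫ σ, spinAt y σ * spinAt z σ ∂μ -
        (∫ σ, spinAt y σ ∂μ) * ∫ σ, spinAt x σ * spinAt z σ ∂μ -
        (∫ σ, spinAt z σ ∂μ) * ∫ σ, spinAt x σ * spinAt y σ ∂μ -
        (∫ σ, spinAt x σ ∂μ) * (∫ σ, spinAt y σ ∂μ) - (∫ σ, spinAt x σ ∂μ) * (∫ σ, spinAt z σ ∂μ) -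
        (∫ σ, spinAt y σ ∂μ) * (∫ σ, spinAt z σ ∂μ) := by
  -- the window containing the three sites, its marginal weight, and the reading of the three spins
  set v : Fin 3 → ι := ![x, y, z] with hv
  set J : Finset ι := Finset.univ.image v with hJ
  have hvJ : ∀ a, v a ∈ J := fun a => Finset.mem_image_of_mem v (Finset.mem_univ a)
  set r : (ι → ℤˣ) → (↥J → ℤˣ) := fun σ => J.restrict σ with hr
  haveI : IsProbabilityMeasure (μ.map r) :=
    Measure.isProbabilityMeasure_map (measurable_finsetRestrict J).aemeasurable
  have hmp : MeasurePreserving r μ (μ.map r) := ⟨measurable_finsetRestrict J, rfl⟩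
  set w : (↥J → ℤˣ) → ℝ := fun q => (μ.map r).real {q} with hw
  have hFKG : IsFKGMeasure w := isFKGMeasure_map_restrict μ hμ J
  set H : LatticeHom (↥J → ℤˣ) (Fin 3 → ℤˣ) :=
    { toFun := fun q a => q ⟨v a, hvJ a⟩
      map_sup' := fun q q' => by funext a; simp only [Pi.sup_apply]
      map_inf' := fun q q' => by funext a; simp only [Pi.inf_apply] } with hH
  -- Sahi's `C₃` for the three up-spin indicators on `{−1,+1}³`
  have key := sahiE_comp_nonneg_of_forall_isFKGMeasure hFKG H
    (fun _ hν => SahiThreeCoordinates.sahiPositive_spinCube_three hν 3)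
    (fun a p => (1 + ((p a : ℤ) : ℝ)) / 2) (fun a p => SahiThreeCoordinates.half_one_add_units_nonneg (p a))
    (fun a => SahiThreeCoordinates.monotone_half_one_add_apply a)
  -- the spins as functions on the window
  set s : Fin 3 → (↥J → ℤˣ) → ℝ := fun a q => ((q ⟨v a, hvJ a⟩ : ℤ) : ℝ) with hs
  have hfun : (fun a => (fun p : Fin 3 → ℤˣ => (1 + ((p a : ℤ) : ℝ)) / 2) ∘ H) = fun a q => (1 + s a q) / 2 := by
    funext a q
    rfl
  rw [hfun, sahiE_three_apply] at key
  rw [SahiThreeCoordinates.ex_half_one_add_mul_three hFKG.sum_eq_one,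
    SahiThreeCoordinates.ex_half_one_add_mul_two hFKG.sum_eq_one,
    SahiThreeCoordinates.ex_half_one_add_mul_two hFKG.sum_eq_one,
    SahiThreeCoordinates.ex_half_one_add_mul_two hFKG.sum_eq_one,
    SahiThreeCoordinates.ex_half_one_add hFKG.sum_eq_one, SahiThreeCoordinates.ex_half_one_add hFKG.sum_eq_one,
    SahiThreeCoordinates.ex_half_one_add hFKG.sum_eq_one] at key
  -- the moments of the marginal weight are the spin moments of `μ`
  have hex : ∀ g : (↥J → ℤˣ) → ℝ, ex w g = ∫ σ, g (r σ) ∂μ := fun g => by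
    rw [hw, ex_real_singleton_eq_integral]
    exact integral_map (measurable_finsetRestrict J).aemeasurable (measurable_of_countable g).aestronglyMeasurable
  have e0 : ex w (s 0) = ∫ σ, spinAt x σ ∂μ := by rw [hex]; rfl
  have e1 : ex w (s 1) = ∫ σ, spinAt y σ ∂μ := by rw [hex]; rfl
  have e2 : ex w (s 2) = ∫ σ, spinAt z σ ∂μ := by rw [hex]; rfl
  have e01 : ex w (s 0 * s 1) = ∫ σ, spinAt x σ * spinAt y σ ∂μ := by rw [hex]; rfl
  have e02 : ex w (s 0 * s 2) = ∫ σ, spinAt x σ * spinAt z σ ∂μ := by rw [hex]; rfl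
  have e12 : ex w (s 1 * s 2) = ∫ σ, spinAt y σ * spinAt z σ ∂μ := by rw [hex]; rfl
  have e012 : ex w (s 0 * s 1 * s 2) = ∫ σ, spinAt x σ * spinAt y σ * spinAt z σ ∂μ := by rw [hex]; rfl
  rw [e0, e1, e2, e01, e02, e12, e012] at key
  nlinarith [key]

end BoxTP2

/-! ### The infinite-volume Ising states on `ℤ^d` -/

section Ising

variable {d : ℕ} {β h : ℝ}

/-- **PLUS STATE: a lower bound on the third Ursell function**, `β ≥ 0`, ANY field `h`, any three sites, for every
probability measure with the plus correlations:
`0 ≤ 2⟨σ_xσ_yσ_z⟩ + ⟨σ_xσ_y⟩ + ⟨σ_xσ_z⟩ + ⟨σ_yσ_z⟩ + ⟨σ_x⟩⟨σ_y⟩⟨σ_z⟩ − ⟨σ_x⟩⟨σ_yσ_z⟩ − ⟨σ_y⟩⟨σ_xσ_z⟩ − ⟨σ_z⟩⟨σ_xσ_y⟩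
− ⟨σ_x⟩⟨σ_y⟩ − ⟨σ_x⟩⟨σ_z⟩ − ⟨σ_y⟩⟨σ_z⟩` (equivalently `U₃ ≥ −½ Σ_cyc (1 + ⟨σ_x⟩)⟨σ_y;σ_z⟩`); UNCONDITIONAL.
[this work] -/
theorem plusState_sahiC3_threeSites (hβ : 0 ≤ β) (μ : Measure (SpinConfig (Site d))) [IsProbabilityMeasure μ]
    (hμ : ∀ B : Finset (Site d), spinCorr μ B = plusCorr d β h B) (x y z : Site d) :
    0 ≤ 2 * ∫ σ, spinAt x σ * spinAt y σ * spinAt z σ ∂μ + ∫ σ, spinAt x σ * spinAt y σ ∂μ +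
        ∫ σ, spinAt x σ * spinAt z σ ∂μ + ∫ σ, spinAt y σ * spinAt z σ ∂μ +
        (∫ σ, spinAt x σ ∂μ) * (∫ σ, spinAt y σ ∂μ) * (∫ σ, spinAt z σ ∂μ) -
        (∫ σ, spinAt x σ ∂μ) * ∫ σ, spinAt y σ * spinAt z σ ∂μ -
        (∫ σ, spinAt y σ ∂μ) * ∫ σ, spinAt x σ * spinAt z σ ∂μ -
        (∫ σ, spinAt z σ ∂μ) * ∫ σ, spinAt x σ * spinAt y σ ∂μ -
        (∫ σ, spinAt x σ ∂μ) * (∫ σ, spinAt y σ ∂μ) - (∫ σ, spinAt x σ ∂μ) * (∫ σ, spinAt z σ ∂μ) -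
        (∫ σ, spinAt y σ ∂μ) * (∫ σ, spinAt z σ ∂μ) :=
  sahiC3_threeSites_of_isBoxTP2 μ (isBoxTP2_of_forall_spinCorr_eq_plusCorr hβ μ hμ) x y z

/-- MINUS STATE, the same bound (`β ≥ 0`, any `h`). [this work] -/
theorem minusState_sahiC3_threeSites (hβ : 0 ≤ β) (μ : Measure (SpinConfig (Site d))) [IsProbabilityMeasure μ]
    (hμ : ∀ B : Finset (Site d), spinCorr μ B = minusCorr d β h B) (x y z : Site d) :
    0 ≤ 2 * ∫ σ, spinAt x σ * spinAt y σ * spinAt z σ ∂μ + ∫ σ, spinAt x σ * spinAt y σ ∂μ +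
        ∫ σ, spinAt x σ * spinAt z σ ∂μ + ∫ σ, spinAt y σ * spinAt z σ ∂μ +
        (∫ σ, spinAt x σ ∂μ) * (∫ σ, spinAt y σ ∂μ) * (∫ σ, spinAt z σ ∂μ) -
        (∫ σ, spinAt x σ ∂μ) * ∫ σ, spinAt y σ * spinAt z σ ∂μ -
        (∫ σ, spinAt y σ ∂μ) * ∫ σ, spinAt x σ * spinAt z σ ∂μ -
        (∫ σ, spinAt z σ ∂μ) * ∫ σ, spinAt x σ * spinAt y σ ∂μ -
        (∫ σ, spinAt x σ ∂μ) * (∫ σ, spinAt y σ ∂μ) - (∫ σ, spinAt x σ ∂μ) * (∫ σ, spinAt z σ ∂μ) -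
        (∫ σ, spinAt y σ ∂μ) * (∫ σ, spinAt z σ ∂μ) :=
  sahiC3_threeSites_of_isBoxTP2 μ (isBoxTP2_of_forall_spinCorr_eq_minusCorr hβ μ hμ) x y z

/-- FREE STATE (`h ≥ 0`), the same bound. [this work] -/
theorem freeState_sahiC3_threeSites (hβ : 0 ≤ β) (hh : 0 ≤ h) (μ : Measure (SpinConfig (Site d)))
    [IsProbabilityMeasure μ] (hμ : ∀ B : Finset (Site d), spinCorr μ B = freeCorr d β h B) (x y z : Site d) :
    0 ≤ 2 * ∫ σ, spinAt x σ * spinAt y σ * spinAt z σ ∂μ + ∫ σ, spinAt x σ * spinAt y σ ∂μ +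
        ∫ σ, spinAt x σ * spinAt z σ ∂μ + ∫ σ, spinAt y σ * spinAt z σ ∂μ +
        (∫ σ, spinAt x σ ∂μ) * (∫ σ, spinAt y σ ∂μ) * (∫ σ, spinAt z σ ∂μ) -
        (∫ σ, spinAt x σ ∂μ) * ∫ σ, spinAt y σ * spinAt z σ ∂μ -
        (∫ σ, spinAt y σ ∂μ) * ∫ σ, spinAt x σ * spinAt z σ ∂μ -
        (∫ σ, spinAt z σ ∂μ) * ∫ σ, spinAt x σ * spinAt y σ ∂μ -
        (∫ σ, spinAt x σ ∂μ) * (∫ σ, spinAt y σ ∂μ) - (∫ σ, spinAt x σ ∂μ) * (∫ σ, spinAt z σ ∂μ) -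
        (∫ σ, spinAt y σ ∂μ) * (∫ σ, spinAt z σ ∂μ) :=
  sahiC3_threeSites_of_isBoxTP2 μ (isBoxTP2_of_forall_spinCorr_eq_freeCorr hβ hh μ hμ) x y z

/-- EVERY TAIL-TRIVIAL (extremal) Ising Gibbs state, the same bound (`β ≥ 0`, any `h`). [this work] -/
theorem sahiC3_threeSites_of_isTailTrivial (hβ : 0 ≤ β) {μ : Measure (SpinConfig (Site d))}
    (hμ : μ ∈ isingGibbsMeasures d β h) (hμt : IsTailTrivial μ) (x y z : Site d) :
    0 ≤ 2 * ∫ σ, spinAt x σ * spinAt y σ * spinAt z σ ∂μ + ∫ σ, spinAt x σ * spinAt y σ ∂μ +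
        ∫ σ, spinAt x σ * spinAt z σ ∂μ + ∫ σ, spinAt y σ * spinAt z σ ∂μ +
        (∫ σ, spinAt x σ ∂μ) * (∫ σ, spinAt y σ ∂μ) * (∫ σ, spinAt z σ ∂μ) -
        (∫ σ, spinAt x σ ∂μ) * ∫ σ, spinAt y σ * spinAt z σ ∂μ -
        (∫ σ, spinAt y σ ∂μ) * ∫ σ, spinAt x σ * spinAt z σ ∂μ -
        (∫ σ, spinAt z σ ∂μ) * ∫ σ, spinAt x σ * spinAt y σ ∂μ -
        (∫ σ, spinAt x σ ∂μ) * (∫ σ, spinAt y σ ∂μ) - (∫ σ, spinAt x σ ∂μ) * (∫ σ, spinAt z σ ∂μ) -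
        (∫ σ, spinAt y σ ∂μ) * (∫ σ, spinAt z σ ∂μ) := by
  have hμG : IsGibbsMeasure (isingSpecification (zdGraph d) β h) μ := hμ
  haveI := hμG.isProbabilityMeasure
  exact sahiC3_threeSites_of_isBoxTP2 μ (isBoxTP2_of_isTailTrivial hβ hμ hμt) x y z

end Ising

end Summit.CriticalPhenomena.PercolationContinuityZ3.Theorems.SahiBoxTP2
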